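import Literature.AnabelianGeometry.SemiGraphs.PSCSeparatingCoveringsClosedSurface
import Literature.AnabelianGeometry.SemiGraphs.PSCTwoComponentAffineOrigin
import Literature.AnabelianGeometry.SemiGraphs.PSCIrreducibleNodalOrigin
import Literature.AnabelianGeometry.SemiGraphs.PSCTwoComponentUnrProp12AllShapes
import HarnessLib

/-!
# [CombGC] Prop. 1.2, proof p. 9: the verticial rows at the ORIGINS of the closed-surface carriers, and their non-vacuity

Mochizuki, *A combinatorial version of the Grothendieck conjecture* [CombGC], PROOF of Prop. 1.2 p. 9
(verticial separating coverings, row P12-L01-V = instance form of abc-iut FACT row F-2826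
`PSCDatum.VerticialSeparatingCoverings`) and Prop. 1.2 (i)/(ii) p. 8, verticial cases
[cite: MochizukiCombGC2007, Prop 1.2 proof p.9] [cite: MochizukiCombGC2007, Prop 1.2(ii) p.8].

PROOF-ONLY companion (abc-iut-w5-d183 gen 5; row «P12@CLOSED-SURFACE ORIGIN+NV» of abc-iut-L3-lead) of
`PSCSeparatingCoveringsClosedSurface.lean`: the datum-level theorems there (`verticialRows_of_twoComponentClosed`,
`verticialRows_of_irreducibleNodalClosed`, carriers `Π = Γ̂_{g,0}`) repackaged

* over every ORIGIN whose data are two-component one-node data with BOTH components unmarked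
  (`twoComponentClosedOrigin_verticialRows`) resp. unpointed irreducible one-nodal data
  (`irreducibleNodalClosedOrigin_verticialRows`) — hypothesis shapes of abc-iut-f-164's
  `exists_twoComponentAffineDatum` (at `r = 0`, `s = 0`) / `exists_irreducibleNodalDatum` (at `r = 0`);
* with [CombGC] Prop. 1.2 (i) IN FULL (row F-0459 `OpenInterDeterminesComponentHolds`) at the two-closed-components
  carrier: verticial case from the vertex twist, edge-like case trivial (ONE node, no cusps), `Π^unr` case by
  abc-iut-f-164's `unrRows_of_twoComponent` (any `r`, `s`) — `openInterDeterminesComponent_of_twoComponentClosed`,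
  `openInterDeterminesComponentHolds_of_twoComponentClosed` (the unpointed `Δ_irr` analogue is already f-164's
  `openInterDeterminesComponentHolds_of_irreducibleNodal`, any `r`);
* NON-VACUOUSLY: those origins are INHABITED for every nonempty set `Σ` of primes and every admissible genus
  splitting (`exists_twoComponentClosedOrigin_verticialRows`: e.g. the unpointed genus-`2` curve breaking into
  two elliptic tails, `Γ_{2,0}`, `g₀ = g₁ = 1`; `exists_irreducibleNodalClosedOrigin_verticialRows`: the unpointed
  irreducible one-nodal curve of arithmetic genus `g ≥ 2`), the data being abc-iut-f-164's constructions over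
  `IsProSigmaCompletion.exists_isProSigmaCompletion (Γ_{g,0})`.

Instance forms at data of the shape of genuine (unpointed) stable curves; consistency evidence for the typed
rows, not the printed theorems for all stable curves.  0 definitions; nothing here takes a side on [IUTchIII]
Cor. 3.12.
-/

noncomputable section

namespace Literature.AnabelianGeometry.SemiGraphs

open scoped Pointwise
open Literature.GroupTheory.CombinatorialGroupTheory
open SemiGraphOfAnabelioids (IsProSigmaCompletion)

namespace PSCDatum

/-! ### Two unmarked components -/

/-- **F-2826, Prop. 1.2 (i) verticial and Prop. 1.2 (ii) verticial at every origin whose data are two-component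
one-node data with BOTH components unmarked** (shape of `exists_twoComponentAffineDatum` at `r = 0`, `s = 0`;
profinite `Π` in `Type`). [cite: MochizukiCombGC2007, Prop 1.2(ii) p.8] -/
theorem twoComponentClosedOrigin_verticialRows (Ω : PSCOrigin.{0})
    (hΩ : ∀ ⦃Q : Type⦄ [Group Q] [TopologicalSpace Q] [IsTopologicalGroup Q] (G : PSCDatum Q),
      Ω.IsOfPSCType G → CompactSpace Q ∧ TotallyDisconnectedSpace Q ∧
        ∃ (S : Set ℕ) (g g₀ : ℕ) (ι : PuncturedSurfaceGroup g 0 →* Q) (v₀ v₁ : G.graph.V)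
          (ε : PuncturedSurfaceGroup g 0),
          S.Nonempty ∧ (∀ p ∈ S, p.Prime) ∧ IsProSigmaCompletion S ι ∧ 1 ≤ g₀ ∧ 1 ≤ g - g₀ ∧
          (∀ w, w = v₀ ∨ w = v₁) ∧
          ε = ((List.finRange 0).map fun j : Fin 0 =>
            if 0 ≤ (j : ℕ) then PuncturedSurfaceGroup.c (g := g) j else 1).prod *
          ((List.finRange g).map fun i : Fin g => if (i : ℕ) < g₀ then
            PuncturedSurfaceGroup.a (r := 0) i * PuncturedSurfaceGroup.b i *
              (PuncturedSurfaceGroup.a i)⁻¹ * (PuncturedSurfaceGroup.b i)⁻¹ else 1).prod ∧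
          G.vertGp v₀ = ((Subgroup.closure {x : PuncturedSurfaceGroup g 0 |
            (∃ i : Fin g, (i : ℕ) < g₀ ∧ (x = PuncturedSurfaceGroup.a i ∨ x = PuncturedSurfaceGroup.b i)) ∨
            ∃ j : Fin 0, 0 ≤ (j : ℕ) ∧ x = PuncturedSurfaceGroup.c j}).map ι).topologicalClosure ∧
          G.vertGp v₁ = ((Subgroup.closure {x : PuncturedSurfaceGroup g 0 |
            (∃ i : Fin g, g₀ ≤ (i : ℕ) ∧ (x = PuncturedSurfaceGroup.a i ∨ x = PuncturedSurfaceGroup.b i)) ∨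
            (∃ j : Fin 0, (j : ℕ) < 0 ∧ x = PuncturedSurfaceGroup.c j) ∨ x = ε}).map ι).topologicalClosure) :
    ∀ ⦃Q : Type⦄ [Group Q] [TopologicalSpace Q] [IsTopologicalGroup Q] (G : PSCDatum Q),
      Ω.IsOfPSCType G → G.VerticialSeparatingCoverings ∧ G.VerticialOpenInterDeterminesVertex ∧
        ∀ A : Subgroup Q, G.IsVerticial A → Subgroup.Commensurable.commensurator A = A := by
  intro Q _ _ _ G hG
  obtain ⟨hc, hd, S, g, g₀, ι, v₀, v₁, ε, hne, hprime, hι, hg₀, hg₁, hV, hε, hV₀, hV₁⟩ := hΩ G hG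
  haveI := hc
  haveI := hd
  exact G.verticialRows_of_twoComponentClosed hne hprime ι hι hg₀ hg₁ v₀ v₁ hV ε hε hV₀ hV₁

/-- **[CombGC] Prop. 1.2 (i) — all three cases — at every two-component one-node datum with BOTH components
unmarked**: verticial (vertex twist), edge-like (trivially: one node and no cusps), `Π^unr`-verticial
(abc-iut-f-164's `unrRows_of_twoComponent`, which carries no `r ≥ 1`). [cite: MochizukiCombGC2007, Prop 1.2(i) p.8] -/
theorem openInterDeterminesComponent_of_twoComponentClosed {P : Type} [Group P] [TopologicalSpace P]
    [IsTopologicalGroup P] [CompactSpace P] [TotallyDisconnectedSpace P] {Sigma : Set ℕ} {g : ℕ}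
    (hne : Sigma.Nonempty) (hprime : ∀ p ∈ Sigma, p.Prime) (ι : PuncturedSurfaceGroup g 0 →* P)
    (hι : IsProSigmaCompletion Sigma ι) (G : PSCDatum P) {g₀ : ℕ} (hg₀ : 1 ≤ g₀) (hg₁ : 1 ≤ g - g₀)
    (e : G.graph.C ≃ Fin 0) (n₀ : G.graph.N) (hN : ∀ n, n = n₀)
    (v₀ v₁ : G.graph.V) (hV : ∀ w, w = v₀ ∨ w = v₁) (ε : PuncturedSurfaceGroup g 0)
    (hε : ε = ((List.finRange 0).map fun j : Fin 0 =>
        if 0 ≤ (j : ℕ) then PuncturedSurfaceGroup.c (g := g) j else 1).prod *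
      ((List.finRange g).map fun i : Fin g => if (i : ℕ) < g₀ then
        PuncturedSurfaceGroup.a (r := 0) i * PuncturedSurfaceGroup.b i *
          (PuncturedSurfaceGroup.a i)⁻¹ * (PuncturedSurfaceGroup.b i)⁻¹ else 1).prod)
    (hV₀ : G.vertGp v₀ = ((Subgroup.closure {x : PuncturedSurfaceGroup g 0 |
        (∃ i : Fin g, (i : ℕ) < g₀ ∧ (x = PuncturedSurfaceGroup.a i ∨ x = PuncturedSurfaceGroup.b i)) ∨
        ∃ j : Fin 0, 0 ≤ (j : ℕ) ∧ x = PuncturedSurfaceGroup.c j}).map ι).topologicalClosure)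
    (hV₁ : G.vertGp v₁ = ((Subgroup.closure {x : PuncturedSurfaceGroup g 0 |
        (∃ i : Fin g, g₀ ≤ (i : ℕ) ∧ (x = PuncturedSurfaceGroup.a i ∨ x = PuncturedSurfaceGroup.b i)) ∨
        (∃ j : Fin 0, (j : ℕ) < 0 ∧ x = PuncturedSurfaceGroup.c j) ∨ x = ε}).map ι).topologicalClosure)
    (hE : G.nodeGp n₀ = ((Subgroup.zpowers ε).map ι).topologicalClosure)
    (hgen₀ : G.genus v₀ = g₀) (hgen₁ : G.genus v₁ = g - g₀) :
    G.VerticialOpenInterDeterminesVertex ∧ G.EdgeLikeOpenInterDeterminesEdge ∧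
      G.UnrVerticialOpenInterDeterminesVertex := by
  refine ⟨(G.verticialRows_of_twoComponentClosed hne hprime ι hι hg₀ hg₁ v₀ v₁ hV ε hε hV₀ hV₁).2.1,
    fun e₁ e₂ γ₁ γ₂ _ => ?_,
    (G.unrRows_of_twoComponent hne hprime ι hι e (fun c' => (e c').elim0) n₀ hN v₀ v₁ hV ε hε hV₀ hV₁ hE
      hgen₀ hgen₁).2.1⟩
  rcases e₁ with n₁ | c₁
  · rcases e₂ with n₂ | c₂
    · rw [hN n₁, hN n₂]
    · exact (e c₂).elim0
  · exact (e c₁).elim0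

/-- **Row F-0459 `OpenInterDeterminesComponentHolds` ([CombGC] Prop. 1.2 (i) as printed) at every origin whose data are
two-component one-node data with both components unmarked** (shape of `exists_twoComponentAffineDatum` at `r = 0`,
`s = 0`, with the node and genus pins). [cite: MochizukiCombGC2007, Prop 1.2(i) p.8] -/
theorem openInterDeterminesComponentHolds_of_twoComponentClosed (Ω : PSCOrigin.{0})
    (hΩ : ∀ ⦃Q : Type⦄ [Group Q] [TopologicalSpace Q] [IsTopologicalGroup Q] (G : PSCDatum Q),
      Ω.IsOfPSCType G → CompactSpace Q ∧ TotallyDisconnectedSpace Q ∧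
        ∃ (S : Set ℕ) (g g₀ : ℕ) (ι : PuncturedSurfaceGroup g 0 →* Q) (e : G.graph.C ≃ Fin 0)
          (v₀ v₁ : G.graph.V) (n₀ : G.graph.N) (ε : PuncturedSurfaceGroup g 0),
          S.Nonempty ∧ (∀ p ∈ S, p.Prime) ∧ IsProSigmaCompletion S ι ∧ 1 ≤ g₀ ∧ 1 ≤ g - g₀ ∧
          (∀ c, G.cuspGp c =
            ((PuncturedSurfaceGroup.cuspInertia (g := g) (e c)).map ι).topologicalClosure) ∧
          (∀ w, w = v₀ ∨ w = v₁) ∧ (∀ n, n = n₀) ∧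
          ε = ((List.finRange 0).map fun j : Fin 0 =>
            if 0 ≤ (j : ℕ) then PuncturedSurfaceGroup.c (g := g) j else 1).prod *
          ((List.finRange g).map fun i : Fin g => if (i : ℕ) < g₀ then
            PuncturedSurfaceGroup.a (r := 0) i * PuncturedSurfaceGroup.b i *
              (PuncturedSurfaceGroup.a i)⁻¹ * (PuncturedSurfaceGroup.b i)⁻¹ else 1).prod ∧
          G.vertGp v₀ = ((Subgroup.closure {x : PuncturedSurfaceGroup g 0 |
            (∃ i : Fin g, (i : ℕ) < g₀ ∧ (x = PuncturedSurfaceGroup.a i ∨ x = PuncturedSurfaceGroup.b i)) ∨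
            ∃ j : Fin 0, 0 ≤ (j : ℕ) ∧ x = PuncturedSurfaceGroup.c j}).map ι).topologicalClosure ∧
          G.vertGp v₁ = ((Subgroup.closure {x : PuncturedSurfaceGroup g 0 |
            (∃ i : Fin g, g₀ ≤ (i : ℕ) ∧ (x = PuncturedSurfaceGroup.a i ∨ x = PuncturedSurfaceGroup.b i)) ∨
            (∃ j : Fin 0, (j : ℕ) < 0 ∧ x = PuncturedSurfaceGroup.c j) ∨ x = ε}).map ι).topologicalClosure ∧
          G.nodeGp n₀ = ((Subgroup.zpowers ε).map ι).topologicalClosure ∧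
          G.genus v₀ = g₀ ∧ G.genus v₁ = g - g₀) :
    OpenInterDeterminesComponentHolds Ω := by
  intro Q _ _ _ G hG
  obtain ⟨hc, hd, S, g, g₀, ι, e, v₀, v₁, n₀, ε, hne, hprime, hι, hg₀, hg₁, -, hV, hN, hε, hV₀, hV₁, hE, hgen₀,
    hgen₁⟩ := hΩ G hG
  haveI := hc
  haveI := hd
  exact G.openInterDeterminesComponent_of_twoComponentClosed hne hprime ι hι hg₀ hg₁ e n₀ hN v₀ v₁ hV ε hε hV₀
    hV₁ hE hgen₀ hgen₁

/-- **Non-vacuity: the origin of two-component data with both components unmarked is INHABITED and every datum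
of it satisfies F-2826 and the verticial cases of Prop. 1.2 (i)/(ii)** — for every nonempty set `Σ` of primes and
genera `g₀, g₁ ≥ 1` (at `g₀ = g₁ = 1`: the unpointed genus-`2` curve breaking into two elliptic tails, `Δ₁ ⊂ ∂M̄₂`),
the inhabitant being abc-iut-f-164's `exists_twoComponentAffineDatum Σ … (g₀ + g₁) 0 g₀ 0` over a pro-`Σ`
completion of the closed surface group `Γ_{g₀+g₁,0}`. [cite: MochizukiCombGC2007, Prop 1.2(ii) p.8] -/
theorem exists_twoComponentClosedOrigin_verticialRows (Sigma : Set ℕ) (hne : Sigma.Nonempty)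
    (hprime : ∀ p ∈ Sigma, p.Prime) {g₀ g₁ : ℕ} (hg₀ : 1 ≤ g₀) (hg₁ : 1 ≤ g₁) :
    ∃ Ω : PSCOrigin.{0},
      (∃ (Q : ProfiniteGrp.{0}) (ι : PuncturedSurfaceGroup (g₀ + g₁) 0 →* Q) (G : PSCDatum Q)
        (v₀ v₁ : G.graph.V),
        IsProSigmaCompletion Sigma ι ∧ Ω.IsOfPSCType G ∧ G.Sigma = Sigma ∧ G.graph.i = 2 ∧ G.graph.n = 1 ∧
          G.graph.r = 0 ∧ (∀ w, w = v₀ ∨ w = v₁) ∧ G.genus v₀ = g₀ ∧ G.genus v₁ = g₁) ∧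
      OpenInterDeterminesComponentHolds Ω ∧
      ∀ ⦃Q : Type⦄ [Group Q] [TopologicalSpace Q] [IsTopologicalGroup Q] (G : PSCDatum Q),
        Ω.IsOfPSCType G → G.VerticialSeparatingCoverings ∧ G.VerticialOpenInterDeterminesVertex ∧
          ∀ A : Subgroup Q, G.IsVerticial A → Subgroup.Commensurable.commensurator A = A := by
  classical
  let Ω : PSCOrigin.{0} :=
    ⟨fun {Q} _ _ G => ∃ (_ : IsTopologicalGroup Q), CompactSpace Q ∧ TotallyDisconnectedSpace Q ∧
        ∃ (S : Set ℕ) (g g₀ : ℕ) (ι : PuncturedSurfaceGroup g 0 →* Q) (e : G.graph.C ≃ Fin 0)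
          (v₀ v₁ : G.graph.V) (n₀ : G.graph.N) (ε : PuncturedSurfaceGroup g 0),
          S.Nonempty ∧ (∀ p ∈ S, p.Prime) ∧ IsProSigmaCompletion S ι ∧ 1 ≤ g₀ ∧ 1 ≤ g - g₀ ∧
          (∀ c, G.cuspGp c =
            ((PuncturedSurfaceGroup.cuspInertia (g := g) (e c)).map ι).topologicalClosure) ∧
          (∀ w, w = v₀ ∨ w = v₁) ∧ (∀ n, n = n₀) ∧
          ε = ((List.finRange 0).map fun j : Fin 0 =>
            if 0 ≤ (j : ℕ) then PuncturedSurfaceGroup.c (g := g) j else 1).prod *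
          ((List.finRange g).map fun i : Fin g => if (i : ℕ) < g₀ then
            PuncturedSurfaceGroup.a (r := 0) i * PuncturedSurfaceGroup.b i *
              (PuncturedSurfaceGroup.a i)⁻¹ * (PuncturedSurfaceGroup.b i)⁻¹ else 1).prod ∧
          G.vertGp v₀ = ((Subgroup.closure {x : PuncturedSurfaceGroup g 0 |
            (∃ i : Fin g, (i : ℕ) < g₀ ∧ (x = PuncturedSurfaceGroup.a i ∨ x = PuncturedSurfaceGroup.b i)) ∨
            ∃ j : Fin 0, 0 ≤ (j : ℕ) ∧ x = PuncturedSurfaceGroup.c j}).map ι).topologicalClosure ∧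
          G.vertGp v₁ = ((Subgroup.closure {x : PuncturedSurfaceGroup g 0 |
            (∃ i : Fin g, g₀ ≤ (i : ℕ) ∧ (x = PuncturedSurfaceGroup.a i ∨ x = PuncturedSurfaceGroup.b i)) ∨
            (∃ j : Fin 0, (j : ℕ) < 0 ∧ x = PuncturedSurfaceGroup.c j) ∨ x = ε}).map ι).topologicalClosure ∧
          G.nodeGp n₀ = ((Subgroup.zpowers ε).map ι).topologicalClosure ∧
          G.genus v₀ = g₀ ∧ G.genus v₁ = g - g₀⟩
  refine ⟨Ω, ?_, openInterDeterminesComponentHolds_of_twoComponentClosed Ω (fun Q _ _ _ G hG => hG.2),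
    twoComponentClosedOrigin_verticialRows Ω fun Q _ _ _ G hG => ?_⟩
  · obtain ⟨Q, ι, G, e, v₀, v₁, n₀, ε, hι, hS, hi, hn, hr, hC, hV, hN, hε, hV₀, hV₁, hE, hgen₀, hgen₁, -⟩ :=
      exists_twoComponentAffineDatum Sigma hne hprime (g₀ + g₁) 0 g₀ 0
    have hG : Ω.IsOfPSCType G := ⟨inferInstance, inferInstance, inferInstance, Sigma, g₀ + g₁, g₀, ι, e, v₀, v₁,
      n₀, ε, hne, hprime, hι, hg₀, by omega, hC, hV, hN, hε, hV₀, hV₁, hE, hgen₀, hgen₁⟩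
    exact ⟨Q, ι, G, v₀, v₁, hι, hG, hS, hi, hn, hr, hV, hgen₀, by rw [hgen₁]; omega⟩
  · obtain ⟨hc, hd, S, g, g₀, ι, -, v₀, v₁, -, ε, hne, hprime, hι, hg₀, hg₁, -, hV, -, hε, hV₀, hV₁, -⟩ := hG.2
    exact ⟨hc, hd, S, g, g₀, ι, v₀, v₁, ε, hne, hprime, hι, hg₀, hg₁, hV, hε, hV₀, hV₁⟩

/-! ### The unpointed irreducible nodal curve -/

/-- **F-2826, Prop. 1.2 (i) verticial and Prop. 1.2 (ii) verticial at every origin whose data are unpointed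
irreducible one-nodal data** (shape of `exists_irreducibleNodalDatum` at `r = 0`, `g ≥ 2`; profinite `Π` in `Type`).
[cite: MochizukiCombGC2007, Prop 1.2(ii) p.8] -/
theorem irreducibleNodalClosedOrigin_verticialRows (Ω : PSCOrigin.{0})
    (hΩ : ∀ ⦃Q : Type⦄ [Group Q] [TopologicalSpace Q] [IsTopologicalGroup Q] (G : PSCDatum Q),
      Ω.IsOfPSCType G → CompactSpace Q ∧ TotallyDisconnectedSpace Q ∧
        ∃ (S : Set ℕ) (g : ℕ) (hg : 1 ≤ g) (ι : PuncturedSurfaceGroup g 0 →* Q) (v₀ : G.graph.V),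
          S.Nonempty ∧ (∀ p ∈ S, p.Prime) ∧ IsProSigmaCompletion S ι ∧ 2 ≤ g ∧ (∀ w, w = v₀) ∧
          G.vertGp v₀ = ((Subgroup.closure {x : PuncturedSurfaceGroup g 0 |
            x = PuncturedSurfaceGroup.b ⟨0, hg⟩ ∨
            x = PuncturedSurfaceGroup.a ⟨0, hg⟩ * PuncturedSurfaceGroup.b ⟨0, hg⟩ * (PuncturedSurfaceGroup.a ⟨0, hg⟩)⁻¹ ∨
            (∃ i : Fin g, 1 ≤ (i : ℕ) ∧ (x = PuncturedSurfaceGroup.a i ∨ x = PuncturedSurfaceGroup.b i)) ∨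
            ∃ j : Fin 0, x = PuncturedSurfaceGroup.c j}).map ι).topologicalClosure) :
    ∀ ⦃Q : Type⦄ [Group Q] [TopologicalSpace Q] [IsTopologicalGroup Q] (G : PSCDatum Q),
      Ω.IsOfPSCType G → G.VerticialSeparatingCoverings ∧ G.VerticialOpenInterDeterminesVertex ∧
        ∀ A : Subgroup Q, G.IsVerticial A → Subgroup.Commensurable.commensurator A = A := by
  intro Q _ _ _ G hG
  obtain ⟨hc, hd, S, g, hg, ι, v₀, hne, hprime, hι, hg2, hV, hV₀⟩ := hΩ G hG
  haveI := hc
  haveI := hd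
  exact G.verticialRows_of_irreducibleNodalClosed hne hprime ι hι hg hg2 v₀ hV hV₀

/-- **Non-vacuity: the origin of unpointed irreducible one-nodal data is INHABITED and every datum of it
satisfies F-2826 and the verticial cases of Prop. 1.2 (i)/(ii)** — for every nonempty set `Σ` of primes and every
arithmetic genus `g ≥ 2`, the inhabitant being abc-iut-f-164's `exists_irreducibleNodalDatum Σ … g 0` (one
vertex of genus `g − 1`, one loop, no cusps) over a pro-`Σ` completion of `Γ_{g,0}`.
[cite: MochizukiCombGC2007, Prop 1.2(ii) p.8] -/
theorem exists_irreducibleNodalClosedOrigin_verticialRows (Sigma : Set ℕ) (hne : Sigma.Nonempty)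
    (hprime : ∀ p ∈ Sigma, p.Prime) {g : ℕ} (hg2 : 2 ≤ g) :
    ∃ Ω : PSCOrigin.{0},
      (∃ (Q : ProfiniteGrp.{0}) (ι : PuncturedSurfaceGroup g 0 →* Q) (G : PSCDatum Q) (v₀ : G.graph.V),
        IsProSigmaCompletion Sigma ι ∧ Ω.IsOfPSCType G ∧ G.Sigma = Sigma ∧ G.graph.i = 1 ∧ G.graph.n = 1 ∧
          G.graph.r = 0 ∧ (∀ w, w = v₀) ∧ G.genus v₀ = g - 1) ∧
      ∀ ⦃Q : Type⦄ [Group Q] [TopologicalSpace Q] [IsTopologicalGroup Q] (G : PSCDatum Q),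
        Ω.IsOfPSCType G → G.VerticialSeparatingCoverings ∧ G.VerticialOpenInterDeterminesVertex ∧
          ∀ A : Subgroup Q, G.IsVerticial A → Subgroup.Commensurable.commensurator A = A := by
  classical
  have hg : 1 ≤ g := by omega
  let Ω : PSCOrigin.{0} :=
    ⟨fun {Q} _ _ G => ∃ (_ : IsTopologicalGroup Q), CompactSpace Q ∧ TotallyDisconnectedSpace Q ∧
        ∃ (S : Set ℕ) (g : ℕ) (hg : 1 ≤ g) (ι : PuncturedSurfaceGroup g 0 →* Q) (v₀ : G.graph.V),
          S.Nonempty ∧ (∀ p ∈ S, p.Prime) ∧ IsProSigmaCompletion S ι ∧ 2 ≤ g ∧ (∀ w, w = v₀) ∧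
          G.vertGp v₀ = ((Subgroup.closure {x : PuncturedSurfaceGroup g 0 |
            x = PuncturedSurfaceGroup.b ⟨0, hg⟩ ∨
            x = PuncturedSurfaceGroup.a ⟨0, hg⟩ * PuncturedSurfaceGroup.b ⟨0, hg⟩ * (PuncturedSurfaceGroup.a ⟨0, hg⟩)⁻¹ ∨
            (∃ i : Fin g, 1 ≤ (i : ℕ) ∧ (x = PuncturedSurfaceGroup.a i ∨ x = PuncturedSurfaceGroup.b i)) ∨
            ∃ j : Fin 0, x = PuncturedSurfaceGroup.c j}).map ι).topologicalClosure⟩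
  refine ⟨Ω, ?_, irreducibleNodalClosedOrigin_verticialRows Ω fun Q _ _ _ G hG => hG.2⟩
  obtain ⟨Q, ι, G, e, v₀, n₀, hι, hS, hi, hn, hr, -, hV, -, -, hV₀, hgen, -⟩ :=
    exists_irreducibleNodalDatum Sigma hne hprime g 0 hg
  have hG : Ω.IsOfPSCType G := ⟨inferInstance, inferInstance, inferInstance, Sigma, g, hg, ι, v₀, hne, hprime, hι,
    hg2, hV, hV₀⟩
  exact ⟨Q, ι, G, v₀, hι, hG, hS, hi, hn, hr, hV, hgen⟩

end PSCDatum

end Literature.AnabelianGeometry.SemiGraphs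

end
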